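import Mathlib
import Summits.Ventures.PercRepro.PuncturedLYMMixT2Q4Table1
import Summits.Ventures.PercRepro.PuncturedLYMMixT2Q4Table2

/-!
# PercRepro — (SP) FOR `2` PAIRWISE DISJOINT TRIPLES AND `4` PAIRWISE DISJOINT QUADRUPLES AT LEVEL `4`: POSITIVITY OF THE DENOMINATORS (1)
(p10, gen 41)

`den > 0`, `Pc > 0` for `n ≥ 22`; `Yc > 0` for `n ≥ 5`.  Nothing here asserts (SP).
-/

namespace PercRepro.PuncturedLYM.Split.TypeLift.MixT2Q4

/-- `den > 0` for `n ≥ 22`. -/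
theorem den_pos (n : ℚ) (hn : 22 ≤ n) : 0 < den n := by
  obtain ⟨n', hn', rfl⟩ : ∃ n', 0 ≤ n' ∧ n = 22 + n' := ⟨n - 22, by linarith, by ring⟩
  have h : den (22 + n') = 373248 * n' ^ 17 + 128646144 * n' ^ 16 + 20860335648 * n' ^ 15 + 2113509025296 * n' ^ 14 + 149850200570472 * n' ^ 13 + 7890096058177068 * n' ^ 12 + 319465812401084196 * n' ^ 11 + 10159811790636272616 * n' ^ 10 + 256927655809617810960 * n' ^ 9 + 5195993471846727866892 * n' ^ 8 + 84033585701733332593812 * n' ^ 7 + 1080645204735157850604048 * n' ^ 6 + 10914468250458317818169136 * n' ^ 5 + 84761228840556576094223808 * n' ^ 4 + 488775889201912848506323584 * n' ^ 3 + 1972090838160043398482681856 * n' ^ 2 + 4970781361311636774803798016 * n' + 5893293760597172672679444480 := by unfold den; ring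
  rw [h]; positivity

/-- `Yc > 0` for `n ≥ 5`. -/
theorem Yc_pos (n : ℚ) (hn : 5 ≤ n) : 0 < Yc n := by
  obtain ⟨n', hn', rfl⟩ : ∃ n', 0 ≤ n' ∧ n = 5 + n' := ⟨n - 5, by linarith, by ring⟩
  have h : Yc (5 + n') = (1 / 120) * n' ^ 5 + (1 / 8) * n' ^ 4 + (17 / 24) * n' ^ 3 + (15 / 8) * n' ^ 2 + (137 / 60) * n' + 1 := by unfold Yc; ring
  rw [h]; positivity

/-- `Pc > 0` for `n ≥ 22`. -/
theorem Pc_pos (n : ℚ) (hn : 22 ≤ n) : 0 < Pc n := by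
  obtain ⟨n', hn', rfl⟩ : ∃ n', 0 ≤ n' ∧ n = 22 + n' := ⟨n - 22, by linarith, by ring⟩
  have h : Pc (22 + n') = (1 / 24) * n' ^ 4 + (41 / 12) * n' ^ 3 + (2519 / 24) * n' ^ 2 + (17155 / 12) * n' + 7273 := by unfold Pc; ring
  rw [h]; positivity

end PercRepro.PuncturedLYM.Split.TypeLift.MixT2Q4
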